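import Summits.QuantumFields.YangMills.Theorems.PoincareLipschitzSphereMapBoxAverageLetters

/-!
# Line «poincare_lipschitz» on crux `HistoryTailL` (stmt-QuantumFields-19936), route crux `BlockLipschitzL` (stmt-QuantumFields-23533), K2 organ of record LOC-REG-MIN —
# FLAT SHADOW «ENERGY → RANGE» (E→R) FOR LATTICE MINIMISERS INTO A SPHERE, FILE 5d-B: MINIMALITY ⟹ THE `Λ`-INEQUALITY —
# from sphere-valued minimality on `Q_r(z)` and the competitor `w = π∘H` (`H = c` off `Q_{R−1}(z)`, `c = u` off `Q_{r−1}(z)`):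
# `E(u; Q_R) ≤ Λ + E(π∘H; Q_R)` with `Λ = E(π∘c; Q_r∖Q_R) − E(u; Q_r∖Q_R) ≤ E(π∘c; X) ≤ 4·E(c; X)` (`X` = where the mollifier differs from `u`)

Cell `ym3-torus` (YM ladder rung R3 = continuum SU(2) Yang–Mills on the three-torus — a RUNG, NOT the Clay problem: not d = 4, not infinite volume, not a mass gap); width seat
`ym-ust-19936-w5` gen 12 (LEAD ym-ust-19936-w1 g8 2026-08-29T05:29:02Z END-GAME «[C] = E→R F5 (★w5) + F6 (px8)»; my LOCATE `E2R-ROAD-w5g12.md` §2 (vii)).  THEOREMS ONLY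
(def-free; `π v = ‖v‖⁻¹ • v` and the bond energy written in place), values in any real inner-product space `V`, lattice letters of lit ✓`B4Eq19LatticeOperators`; uses ★w5 g12's
✓`PoincareLipschitzSphereMapBoxAverageLetters.energy_normalize_le`; `--supports stmt-QuantumFields-19936`.  Nothing here proves E→R, LOC-REG-MIN, `hReg`, `hImprove`, a stub,
`BlockLipschitzL`, `HistoryTailL` or a summit statement.

THE MINIMALITY LETTER (as announced on the bus 05:43Z; [T2]'s transfer may restate it): `hminU : ∀ w, (∀ y, ‖w y‖ = 1) → (∀ y ∉ Q_{r−1}(z), w y = u y) →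
E(u; Q_r(z)) ≤ E(w; Q_r(z))` — `u` minimises the bond energy `Σ_{y∈Q_r}Σ_μ‖·(y+e_μ) − ·(y)‖²` among UNIT-sphere-valued fields agreeing with it off the interior `Q_{r−1}(z)`.
* §1 `norm_normalize_eq_one`, `normalize_eq_self` (`‖v‖ = 1 ⇒ π v = v`), `energy_split` (`E(f;Q_r) = E(f;Q_R) + E(f;Q_r∖Q_R)` for `R ≤ r`),
  `normalize_congr_off` (off `Q_{R−1}`: `π∘H = π∘c` at both ends of every bond from `Q_r ∖ Q_R`).
* §2 ★★★ `minimality_split` — `hminU`, `‖u‖ = 1`, `H ≠ 0` everywhere, `H = c` off `Q_{R−1}(z)`, `c = u` off `Q_{r−1}(z)`, `R ≤ r` ⟹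
  `E(u; Q_R) ≤ [E(π∘c; Q_r∖Q_R) − E(u; Q_r∖Q_R)] + E(π∘H; Q_R)` — the `hmin` slot of ✓`interior_comparison` ∕ ✓`energy_decay_of_comparison`.
* §4 ★★★ `minimality_split_of_slack` — the same with an additive almost-minimality slack `+ sl` (LEAD's «TWIST SLACK» interface).
* §3 ★★ `layer_cost_le` — if `c = u` at both ends of every bond from `(Q_r∖Q_R) ∖ X` then `E(π∘c; Q_r∖Q_R) − E(u; Q_r∖Q_R) ≤ E(π∘c; X)`; ★ `layer_cost_le_four_mul`
  (`‖c‖ ≥ ½` on `X` and its forward neighbours ⟹ `… ≤ 4·E(c; X)` by ✓`energy_normalize_le`) — then F4 ✓`energy_mollifier_le` bounds `E(c; X)` by `E(u; U)`.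
[folklore] ([SchoenUhlenbeck1982] §4 (comparison with the projected harmonic replacement); the lattice statements are this file's).
-/

set_option autoImplicit false

noncomputable section

open scoped BigOperators InnerProductSpace
open Finset

namespace Summit.QuantumFields.YangMills.Theorems.PoincareLipschitzSphereMapMinimalitySplit

open Literature.MathematicalPhysics.QuantumFieldTheory.Balaban1983to89
open B4Eq19LatticeOperators
open Summit.QuantumFields.YangMills.Theorems.PoincareLipschitzSphereMapBoxAverageLetters (energy_normalize_le)

variable {d : ℕ} {V : Type*} [NormedAddCommGroup V] [InnerProductSpace ℝ V]

/-! ## §1 Letters -/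

omit [InnerProductSpace ℝ V] in
/-- `‖‖v‖⁻¹ • v‖ = 1` for `v ≠ 0` (real scalars). [folklore] -/
theorem norm_normalize_eq_one [NormedSpace ℝ V] {v : V} (hv : v ≠ 0) : ‖(‖v‖)⁻¹ • v‖ = 1 := by
  rw [norm_smul, Real.norm_eq_abs, abs_of_pos (inv_pos.2 (norm_pos_iff.2 hv)), inv_mul_cancel₀ (norm_pos_iff.2 hv).ne']

omit [InnerProductSpace ℝ V] in
/-- `‖v‖ = 1 ⇒ ‖v‖⁻¹ • v = v`. [folklore] -/
theorem normalize_eq_self [NormedSpace ℝ V] {v : V} (hv : ‖v‖ = 1) : (‖v‖)⁻¹ • v = v := by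
  rw [hv, inv_one, one_smul]

omit [InnerProductSpace ℝ V] in
/-- **Splitting the energy over nested boxes**: `R ≤ r` ⟹ `E(f; Q_r) = E(f; Q_R) + E(f; Q_r ∖ Q_R)`. [folklore] -/
theorem energy_split (f : Zd d → V) (z : Zd d) {R r : ℤ} (hRr : R ≤ r) :
    ∑ y ∈ box z r, ∑ μ, ‖f (y + unitVec μ) - f y‖ ^ 2 =
      ∑ y ∈ box z R, ∑ μ, ‖f (y + unitVec μ) - f y‖ ^ 2 + ∑ y ∈ box z r \ box z R, ∑ μ, ‖f (y + unitVec μ) - f y‖ ^ 2 := by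
  classical
  rw [← Finset.sum_sdiff (box_mono z hRr), add_comm]

/-! ## §2 Minimality ⟹ the `Λ`-inequality -/

/-- ★★★ **MINIMALITY SPLIT.**  `u` unit-valued and minimising on `Q_r(z)` among unit fields agreeing with it off `Q_{r−1}(z)` (`hminU`); `H ≠ 0` everywhere, `H = c` off `Q_{R−1}(z)`,
`c = u` off `Q_{r−1}(z)`, `R ≤ r`.  THEN, with `π v = ‖v‖⁻¹ • v`:
`E(u; Q_R) ≤ (E(π∘c; Q_r∖Q_R) − E(u; Q_r∖Q_R)) + E(π∘H; Q_R)`. [folklore] [cite: SchoenUhlenbeck1982, §4] -/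
theorem minimality_split (u c H : Zd d → V) (z : Zd d) {R r : ℤ} (hRr : R ≤ r) (hu : ∀ y, ‖u y‖ = 1)
    (hminU : ∀ w : Zd d → V, (∀ y, ‖w y‖ = 1) → (∀ y ∉ box z (r - 1), w y = u y) →
      ∑ y ∈ box z r, ∑ μ, ‖u (y + unitVec μ) - u y‖ ^ 2 ≤ ∑ y ∈ box z r, ∑ μ, ‖w (y + unitVec μ) - w y‖ ^ 2)
    (hH0 : ∀ y, H y ≠ 0) (hHc : ∀ y ∉ box z (R - 1), H y = c y) (hcu : ∀ y ∉ box z (r - 1), c y = u y) :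
    ∑ y ∈ box z R, ∑ μ, ‖u (y + unitVec μ) - u y‖ ^ 2 ≤
      (∑ y ∈ box z r \ box z R, ∑ μ, ‖(‖c (y + unitVec μ)‖)⁻¹ • c (y + unitVec μ) - (‖c y‖)⁻¹ • c y‖ ^ 2 -
          ∑ y ∈ box z r \ box z R, ∑ μ, ‖u (y + unitVec μ) - u y‖ ^ 2) +
        ∑ y ∈ box z R, ∑ μ, ‖(‖H (y + unitVec μ)‖)⁻¹ • H (y + unitVec μ) - (‖H y‖)⁻¹ • H y‖ ^ 2 := by
  classical
  set w : Zd d → V := fun y => (‖H y‖)⁻¹ • H y with hw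
  have hw1 : ∀ y, ‖w y‖ = 1 := fun y => norm_normalize_eq_one (hH0 y)
  -- `w = u` off `Q_{r−1}(z)`
  have hwu : ∀ y ∉ box z (r - 1), w y = u y := by
    intro y hy
    have hyR : y ∉ box z (R - 1) := fun h => hy (box_mono z (by linarith) h)
    show (‖H y‖)⁻¹ • H y = u y
    rw [hHc y hyR, hcu y hy, normalize_eq_self (hu y)]
  have hmin := hminU w hw1 hwu
  rw [energy_split u z hRr, energy_split w z hRr] at hmin
  -- on the outer part `w = π∘c` at both ends of every bond
  have hout : ∑ y ∈ box z r \ box z R, ∑ μ, ‖w (y + unitVec μ) - w y‖ ^ 2 =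
      ∑ y ∈ box z r \ box z R, ∑ μ, ‖(‖c (y + unitVec μ)‖)⁻¹ • c (y + unitVec μ) - (‖c y‖)⁻¹ • c y‖ ^ 2 := by
    refine Finset.sum_congr rfl fun y hy => Finset.sum_congr rfl fun μ _ => ?_
    rw [Finset.mem_sdiff] at hy
    have hyR : y ∉ box z (R - 1) := fun h => hy.2 (box_mono z (by linarith) h)
    have hyR' : y + unitVec μ ∉ box z (R - 1) := by
      have : y ∉ box z ((R - 1) + 1) := by rw [sub_add_cancel]; exact hy.2
      exact add_unitVec_not_mem_box this μ
    show ‖(‖H (y + unitVec μ)‖)⁻¹ • H (y + unitVec μ) - (‖H y‖)⁻¹ • H y‖ ^ 2 = _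
    rw [hHc y hyR, hHc _ hyR']
  rw [hout] at hmin
  linarith

/-! ## §3 The layer cost -/

/-- ★★ **THE LAYER COST LIVES WHERE THE MOLLIFIER DIFFERS FROM `u`**: if `X ⊆ Q_r∖Q_R` and `c = u` at both ends of every bond from `(Q_r∖Q_R) ∖ X` (`‖u‖ = 1`), then
`E(π∘c; Q_r∖Q_R) − E(u; Q_r∖Q_R) ≤ E(π∘c; X)`. [folklore] -/
theorem layer_cost_le (u c : Zd d → V) (z : Zd d) {R r : ℤ} (hu : ∀ y, ‖u y‖ = 1) (X : Finset (Zd d)) (hX : X ⊆ box z r \ box z R)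
    (hcu : ∀ y ∈ (box z r \ box z R) \ X, c y = u y ∧ ∀ μ : Fin d, c (y + unitVec μ) = u (y + unitVec μ)) :
    ∑ y ∈ box z r \ box z R, ∑ μ, ‖(‖c (y + unitVec μ)‖)⁻¹ • c (y + unitVec μ) - (‖c y‖)⁻¹ • c y‖ ^ 2 -
        ∑ y ∈ box z r \ box z R, ∑ μ, ‖u (y + unitVec μ) - u y‖ ^ 2 ≤
      ∑ y ∈ X, ∑ μ, ‖(‖c (y + unitVec μ)‖)⁻¹ • c (y + unitVec μ) - (‖c y‖)⁻¹ • c y‖ ^ 2 := by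
  classical
  set S := box z r \ box z R with hS
  set P : Zd d → ℝ := fun y => ∑ μ, ‖(‖c (y + unitVec μ)‖)⁻¹ • c (y + unitVec μ) - (‖c y‖)⁻¹ • c y‖ ^ 2 with hP
  set Eu : Zd d → ℝ := fun y => ∑ μ, ‖u (y + unitVec μ) - u y‖ ^ 2 with hEu
  have hP0 : ∀ y, 0 ≤ P y := fun y => Finset.sum_nonneg fun _ _ => by positivity
  have hEu0 : ∀ y, 0 ≤ Eu y := fun y => Finset.sum_nonneg fun _ _ => by positivity
  -- split `S = X ∪ (S ∖ X)`; on `S ∖ X` the two energies agree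
  have hsplitP : ∑ y ∈ S, P y = ∑ y ∈ X, P y + ∑ y ∈ S \ X, P y := by rw [← Finset.sum_sdiff hX, add_comm]
  have hsplitE : ∑ y ∈ S, Eu y = ∑ y ∈ X, Eu y + ∑ y ∈ S \ X, Eu y := by rw [← Finset.sum_sdiff hX, add_comm]
  have hagree : ∑ y ∈ S \ X, P y = ∑ y ∈ S \ X, Eu y := by
    refine Finset.sum_congr rfl fun y hy => Finset.sum_congr rfl fun μ _ => ?_
    obtain ⟨h1, h2⟩ := hcu y hy
    rw [h1, h2 μ, normalize_eq_self (hu _), normalize_eq_self (hu _)]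
  have hXE : 0 ≤ ∑ y ∈ X, Eu y := Finset.sum_nonneg fun y _ => hEu0 y
  show ∑ y ∈ S, P y - ∑ y ∈ S, Eu y ≤ ∑ y ∈ X, P y
  rw [hsplitP, hsplitE, hagree]
  linarith

/-- ★ **… AND IS AT MOST FOUR TIMES THE MOLLIFIER'S ENERGY THERE**: if moreover `‖c‖ ≥ ½` on `X` and on its forward neighbours, then
`E(π∘c; Q_r∖Q_R) − E(u; Q_r∖Q_R) ≤ 4·E(c; X)` (✓`energy_normalize_le` with `m = ½`). [folklore] -/
theorem layer_cost_le_four_mul (u c : Zd d → V) (z : Zd d) {R r : ℤ} (hu : ∀ y, ‖u y‖ = 1) (X : Finset (Zd d)) (hX : X ⊆ box z r \ box z R)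
    (hcu : ∀ y ∈ (box z r \ box z R) \ X, c y = u y ∧ ∀ μ : Fin d, c (y + unitVec μ) = u (y + unitVec μ))
    (hc : ∀ y ∈ X, (1 / 2 : ℝ) ≤ ‖c y‖) (hc' : ∀ y ∈ X, ∀ μ : Fin d, (1 / 2 : ℝ) ≤ ‖c (y + unitVec μ)‖) :
    ∑ y ∈ box z r \ box z R, ∑ μ, ‖(‖c (y + unitVec μ)‖)⁻¹ • c (y + unitVec μ) - (‖c y‖)⁻¹ • c y‖ ^ 2 -
        ∑ y ∈ box z r \ box z R, ∑ μ, ‖u (y + unitVec μ) - u y‖ ^ 2 ≤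
      4 * ∑ y ∈ X, ∑ μ, ‖c (y + unitVec μ) - c y‖ ^ 2 := by
  have h1 := layer_cost_le u c z hu X hX hcu
  have h2 := energy_normalize_le X c (by norm_num : (0 : ℝ) < 1 / 2) hc hc'
  have e : (((1 / 2 : ℝ)) ^ 2)⁻¹ = 4 := by norm_num
  rw [e] at h2
  exact h1.trans h2

/-! ## §4 The same with an additive minimality slack (LEAD ★w1 g8 06:02:29Z «TWIST SLACK»: the twisted minimiser is an ALMOST-minimiser of the flat energy) -/

/-- ★★★ **MINIMALITY SPLIT WITH SLACK**: if `u` is only an ALMOST-minimiser — `E(u; Q_r) ≤ E(w; Q_r) + sl` for every unit field `w` agreeing with `u` off `Q_{r−1}(z)` — then,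
with the same competitor `π∘H`, `E(u; Q_R) ≤ (E(π∘c; Q_r∖Q_R) − E(u; Q_r∖Q_R) + sl) + E(π∘H; Q_R)`: the slack just ADDS to the layer cost `Λ` of ✓`interior_comparison` ∕
✓`energy_decay_of_comparison` (whose `Λ` is an arbitrary real), so the whole one-step chain carries `+ 2·sl`. [folklore] [cite: SchoenUhlenbeck1982, §4] -/
theorem minimality_split_of_slack (u c H : Zd d → V) (z : Zd d) {R r : ℤ} (hRr : R ≤ r) (hu : ∀ y, ‖u y‖ = 1) {sl : ℝ}
    (hminU : ∀ w : Zd d → V, (∀ y, ‖w y‖ = 1) → (∀ y ∉ box z (r - 1), w y = u y) →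
      ∑ y ∈ box z r, ∑ μ, ‖u (y + unitVec μ) - u y‖ ^ 2 ≤ ∑ y ∈ box z r, ∑ μ, ‖w (y + unitVec μ) - w y‖ ^ 2 + sl)
    (hH0 : ∀ y, H y ≠ 0) (hHc : ∀ y ∉ box z (R - 1), H y = c y) (hcu : ∀ y ∉ box z (r - 1), c y = u y) :
    ∑ y ∈ box z R, ∑ μ, ‖u (y + unitVec μ) - u y‖ ^ 2 ≤
      (∑ y ∈ box z r \ box z R, ∑ μ, ‖(‖c (y + unitVec μ)‖)⁻¹ • c (y + unitVec μ) - (‖c y‖)⁻¹ • c y‖ ^ 2 -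
          ∑ y ∈ box z r \ box z R, ∑ μ, ‖u (y + unitVec μ) - u y‖ ^ 2 + sl) +
        ∑ y ∈ box z R, ∑ μ, ‖(‖H (y + unitVec μ)‖)⁻¹ • H (y + unitVec μ) - (‖H y‖)⁻¹ • H y‖ ^ 2 := by
  classical
  set w : Zd d → V := fun y => (‖H y‖)⁻¹ • H y with hw
  have hw1 : ∀ y, ‖w y‖ = 1 := fun y => norm_normalize_eq_one (hH0 y)
  have hwu : ∀ y ∉ box z (r - 1), w y = u y := by
    intro y hy
    have hyR : y ∉ box z (R - 1) := fun h => hy (box_mono z (by linarith) h)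
    show (‖H y‖)⁻¹ • H y = u y
    rw [hHc y hyR, hcu y hy, normalize_eq_self (hu y)]
  have hmin := hminU w hw1 hwu
  rw [energy_split u z hRr, energy_split w z hRr] at hmin
  have hout : ∑ y ∈ box z r \ box z R, ∑ μ, ‖w (y + unitVec μ) - w y‖ ^ 2 =
      ∑ y ∈ box z r \ box z R, ∑ μ, ‖(‖c (y + unitVec μ)‖)⁻¹ • c (y + unitVec μ) - (‖c y‖)⁻¹ • c y‖ ^ 2 := by
    refine Finset.sum_congr rfl fun y hy => Finset.sum_congr rfl fun μ _ => ?_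
    rw [Finset.mem_sdiff] at hy
    have hyR : y ∉ box z (R - 1) := fun h => hy.2 (box_mono z (by linarith) h)
    have hyR' : y + unitVec μ ∉ box z (R - 1) := by
      have : y ∉ box z ((R - 1) + 1) := by rw [sub_add_cancel]; exact hy.2
      exact add_unitVec_not_mem_box this μ
    show ‖(‖H (y + unitVec μ)‖)⁻¹ • H (y + unitVec μ) - (‖H y‖)⁻¹ • H y‖ ^ 2 = _
    rw [hHc y hyR, hHc _ hyR']
  rw [hout] at hmin
  linarith

end Summit.QuantumFields.YangMills.Theorems.PoincareLipschitzSphereMapMinimalitySplit
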